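import Summits.AtomisticToContinuum.FouriersLaw.Theorems.BondHeatUncertaintyExtensiveSnapshotIrreversibilityEnergyWindowSkeletonWeights
import Summits.AtomisticToContinuum.FouriersLaw.Theorems.BondHeatUncertaintyExtensiveSnapshotIrreversibilityEnergyWindowFlowJacobian

/-!
# Energy window, part S′p — pathwise bound on the momentum-direction Jacobian of the flow

Lineage `stmt-AtomisticToContinuum-9121` (`ExtensiveSnapshotIrreversibility`), K_fix half, leaf S3
`KernelTemperatureLipschitz`; support leaf **(JM) `FlowJacobianMoment`** of part R.  Second of the
three (JM) files (S′a deterministic ingredients → S′p this file → S′b moments).  Imports S′a and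
part R (`…EnergyWindowSkeletonWeights`, for `contDiff_solMap_pairPath`: the solution map at time
`s` is `C^∞` in the starting point for every driving path) — lands after R.

What is proved here (all complete, no placeholders):

* §3 `momShift`, `chainFlow_perturbedNoise_momShift` — shifting the bath noise by the constant
  path `x · e` is the same as shifting the initial momentum by `x · e` (both flows solve the same
  forced equation), so the tree's variational calculus in the NOISE parameter
  (`LangevinChainVariational`: `pinnedChainVariation`, `pinnedChainVariation_eq`) computes the
  derivative of the flow in the initial MOMENTUM (`fderiv_solMap_momentum_eq_variation`).
* §4 `norm_fderiv_solMap_momentum_le` — for every driving path, every `s ∈ [0, 1]`, every site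
  `b` and every starting point `z`:
  `‖∂_z Φ_s(z, B)[(0, e_b)]‖ ≤ exp(∫₀ˢ (A₀ + A₁ √H(Φ_u(z, B))) du)`,
  by S′a's variable-coefficient Grönwall applied to the variational equation with S′a's drift
  bound.

[folklore] (the classical `C e^{C ∫|p|}` first-variation bound for polynomially confining
Hamiltonian SDEs; here in the weaker-hypothesis form `√H` instead of `|p|`, which is all (JM)
needs; the energy moments it is combined with are
[cite: CuneoEckmannHairerReyBellet2018, §3 eq. (3.4)]).
-/

noncomputable section

namespace Summit.AtomisticToContinuum.FouriersLaw.Theorems.ExtensiveSnapshotIrreversibility.EnergyWindow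

open MeasureTheory Filter Topology Real unitInterval Set
open scoped ENNReal NNReal ContDiff
open Literature.MathematicalPhysics.KineticTheory.HeatConduction
open Literature.Probability.Process Literature.Analysis.ODE

/-! ## 3. Shifting the noise by a constant path = shifting the initial momentum -/

/-- The embedding `x ↦ (t ↦ x · e)` of a momentum vector `e` as a CONSTANT noise path
on `[0, 1]`. [folklore] -/
def momShift (N : ℕ) (e : Fin N → ℝ) : ℝ →L[ℝ] C(I, Fin N → ℝ) :=
  (ContinuousLinearMap.id ℝ ℝ).smulRight (ContinuousMap.const I e)

/-- `momShift N e x τ = x • e`. [folklore] -/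
@[simp] theorem momShift_apply (N : ℕ) (e : Fin N → ℝ) (x : ℝ) (τ : I) :
    momShift N e x τ = x • e := rfl

/-- The perturbed noise along `momShift` is `η₀ + x • e`. [folklore] -/
theorem perturbedNoise_momShift (N : ℕ) (η₀ : ℝ → Fin N → ℝ) (e : Fin N → ℝ) (x t : ℝ) :
    perturbedNoise η₀ (momShift N e) x t = η₀ t + x • e := rfl

/-- At `x = 0` the noise is unchanged. [folklore] -/
theorem perturbedNoise_momShift_zero (N : ℕ) (η₀ : ℝ → Fin N → ℝ) (e : Fin N → ℝ) :
    perturbedNoise η₀ (momShift N e) 0 = η₀ := by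
  funext t; rw [perturbedNoise_momShift, zero_smul, add_zero]

/-- **Constant noise shift = momentum shift of the initial condition**: the flow driven by
`η₀ + x·e` from `z` is the flow driven by `η₀` from `z + (0, x·e)` (both are the forced solution
with forcing `t ↦ z + (0, η₀ t + x·e)`). [folklore] -/
theorem chainFlow_perturbedNoise_momShift (P : OscillatorChain) (N : ℕ) (z : PhaseSpace N)
    (η₀ : ℝ → Fin N → ℝ) (e : Fin N → ℝ) (x : ℝ) :
    P.chainFlow N z (perturbedNoise η₀ (momShift N e) x) =
      P.chainFlow N (z + ((0 : Fin N → ℝ), x • e)) η₀ := by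
  have hf : OscillatorChain.forcing z (perturbedNoise η₀ (momShift N e) x) =
      OscillatorChain.forcing (z + ((0 : Fin N → ℝ), x • e)) η₀ := by
    funext t
    show z + ((0 : Fin N → ℝ), η₀ t + x • e) =
      z + ((0 : Fin N → ℝ), x • e) + ((0 : Fin N → ℝ), η₀ t)
    ext i
    · simp only [Prod.fst_add, Pi.add_apply, Pi.zero_apply, add_zero]
    · simp only [Prod.snd_add, Pi.add_apply]; ring
  funext t
  simp only [OscillatorChain.chainFlow, OscillatorChain.truncSol, hf]

/-! ## 4. The pathwise bound on the momentum-direction Jacobian -/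

section Pathwise

variable {ω₂ lam β γ : ℝ} (hω : 0 < ω₂) (hl : 0 ≤ lam) (hβ : 0 ≤ β) (hγ : 0 ≤ γ) (N : ℕ)
  (T_L T_R : ℝ)

include hω hl hβ hγ in
/-- **The derivative of the flow in a bath-momentum direction is the variational solution** of the
tree's noise-parameter calculus for the constant shift `momShift`: for `s ∈ [0, 1]`,
`∂_z Φ_s(z, B)[(0, e)] = pinnedChainVariation … (momShift N e) 0 1 s`. [folklore] -/
theorem fderiv_solMap_momentum_eq_variation {s : ℝ} (hs : s ∈ Icc (0 : ℝ) 1) (e : Fin N → ℝ)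
    (z : PhaseSpace N) (wp : WienerPair) :
    fderiv ℝ (fun z' => (pinnedChain ω₂ lam β γ).solMap N T_L T_R s z' (pairPath wp)) z
        ((0 : Fin N → ℝ), e) =
      pinnedChainVariation hω hl hβ hγ N z
        (continuous_chainNoise_rem ω₂ lam β γ N T_L T_R (pairPath wp)) (momShift N e) 0 1 s := by
  set η₀ : ℝ → Fin N → ℝ :=
    chainNoise N (ampL ω₂ lam β γ T_L) (ampR ω₂ lam β γ T_R) (pairPath wp) with hη₀_def
  have hη₀ : Continuous η₀ := continuous_chainNoise_rem ω₂ lam β γ N T_L T_R (pairPath wp)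
  set v : PhaseSpace N := ((0 : Fin N → ℝ), e) with hv
  set F : PhaseSpace N → PhaseSpace N :=
    fun z' => (pinnedChain ω₂ lam β γ).solMap N T_L T_R s z' (pairPath wp) with hF
  -- the curve `x ↦ F (z + x v)` is the noise-shifted flow at time `s`
  have hG : (fun x : ℝ => F (z + x • v)) =
      fun x => (pinnedChain ω₂ lam β γ).chainFlow N z (perturbedNoise η₀ (momShift N e) x) s := by
    funext x
    rw [chainFlow_perturbedNoise_momShift]
    show (pinnedChain ω₂ lam β γ).chainFlow N (z + x • v) η₀ s = _
    rw [hv, Prod.smul_mk, smul_zero]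
  -- derivative of `x ↦ F (z + x v)` at `0` by the chain rule
  have h1 : HasDerivAt (fun x : ℝ => F (z + x • v)) (fderiv ℝ F z v) 0 := by
    have hFd : DifferentiableAt ℝ F z :=
      ((contDiff_solMap_pairPath hω hl hβ hγ N T_L T_R hs wp).differentiable (by simp)) z
    have hin : HasDerivAt (fun x : ℝ => z + x • v) v 0 := by
      simpa using ((hasDerivAt_id (0 : ℝ)).smul_const v).const_add z
    have hFd' : HasFDerivAt F (fderiv ℝ F z) (z + (0 : ℝ) • v) := by
      rw [zero_smul, add_zero]; exact hFd.hasFDerivAt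
    exact hFd'.comp_hasDerivAt (0 : ℝ) hin
  -- derivative of the noise-shifted flow at `0` from the smooth solution curve
  have h2 : HasDerivAt
      (fun x : ℝ => (pinnedChain ω₂ lam β γ).chainFlow N z (perturbedNoise η₀ (momShift N e) x) s)
      (pinnedChainVariation hω hl hβ hγ N z hη₀ (momShift N e) 0 1 s) 0 := by
    have hd : DifferentiableAt ℝ (pinnedChainSolCurve hω hl hβ hγ N z hη₀ (momShift N e)) 0 :=
      (contDiff_pinnedChainSolCurve hω hl hβ hγ N z hη₀ (momShift N e)).differentiable
        (by simp) 0
    have h := ((ContinuousMap.evalCLM ℝ (⟨s, hs⟩ : I)).hasFDerivAt.comp (0 : ℝ)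
      hd.hasFDerivAt).hasDerivAt
    have hws : pinnedChainVariation hω hl hβ hγ N z hη₀ (momShift N e) 0 1 s =
        ((ContinuousMap.evalCLM ℝ (⟨s, hs⟩ : I)).comp
          (fderiv ℝ (pinnedChainSolCurve hω hl hβ hγ N z hη₀ (momShift N e)) 0)) 1 := by
      rw [pinnedChainVariation, IccExtend_of_mem _ _ hs]; rfl
    rw [hws]
    exact h
  rw [hG] at h1
  exact h1.unique h2

include hω hl hβ hγ in
/-- **Pathwise Grönwall bound for the momentum-direction Jacobian.** For every driving path,
`s ∈ [0, 1]`, site `b`, starting point `z`: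
`‖∂_z Φ_s(z, B)[(0, e_b)]‖ ≤ exp(∫₀ˢ (A₀ + A₁ √H(Φ_u(z, B))) du)`. [folklore] -/
theorem norm_fderiv_solMap_momentum_le {s : ℝ} (hs : s ∈ Icc (0 : ℝ) 1) (b : Fin N)
    (z : PhaseSpace N) (wp : WienerPair) :
    ‖fderiv ℝ (fun z' => (pinnedChain ω₂ lam β γ).solMap N T_L T_R s z' (pairPath wp)) z
        ((0 : Fin N → ℝ), Pi.single b 1)‖ ≤
      Real.exp (∫ u in (0 : ℝ)..s, (driftA₀ ω₂ γ N + driftA₁ lam β N *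
        √((pinnedChain ω₂ lam β γ).hamiltonian N
          ((pinnedChain ω₂ lam β γ).solMap N T_L T_R u z (pairPath wp))))) := by
  have hη₀ : Continuous (chainNoise N (ampL ω₂ lam β γ T_L) (ampR ω₂ lam β γ T_R) (pairPath wp)) :=
    continuous_chainNoise_rem ω₂ lam β γ N T_L T_R (pairPath wp)
  set w : ℝ → PhaseSpace N :=
    pinnedChainVariation hω hl hβ hγ N z hη₀ (momShift N (Pi.single b (1 : ℝ))) 0 1 with hw_def
  set v : PhaseSpace N := ((0 : Fin N → ℝ), Pi.single b (1 : ℝ)) with hv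
  -- the integral equation of `w` on `[0, 1]`
  have heq : ∀ τ ∈ Icc (0 : ℝ) 1, w τ = v + ∫ u in (0 : ℝ)..τ,
      (fderiv ℝ ((pinnedChain ω₂ lam β γ).drift N)
        ((pinnedChain ω₂ lam β γ).solMap N T_L T_R u z (pairPath wp))) (w u) := by
    intro τ hτ
    have h := pinnedChainVariation_eq hω hl hβ hγ N z hη₀ (momShift N (Pi.single b (1 : ℝ))) 0 1 hτ
    rw [hw_def, h]
    simp only [perturbedNoise_momShift_zero, momShift_apply, one_smul]
    rfl
  have hw : Continuous w :=
    continuous_pinnedChainVariation hω hl hβ hγ N z hη₀ (momShift N (Pi.single b (1 : ℝ))) 0 1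
  have hAc : Continuous fun u => fderiv ℝ ((pinnedChain ω₂ lam β γ).drift N)
      ((pinnedChain ω₂ lam β γ).solMap N T_L T_R u z (pairPath wp)) :=
    continuous_fderiv_drift_solMap hω hl hβ hγ N T_L T_R z wp
  have hac : Continuous fun u => driftA₀ ω₂ γ N + driftA₁ lam β N *
      √((pinnedChain ω₂ lam β γ).hamiltonian N
        ((pinnedChain ω₂ lam β γ).solMap N T_L T_R u z (pairPath wp))) :=
    continuous_const.add (continuous_const.mul
      (((pinnedChain_continuous_hamiltonian ω₂ lam β γ N).comp
        (pinnedChain_continuous_solMap hω hl hβ hγ N T_L T_R z (pairPath wp))).sqrt))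
  have hAa : ∀ t u, ‖(fderiv ℝ ((pinnedChain ω₂ lam β γ).drift N)
      ((pinnedChain ω₂ lam β γ).solMap N T_L T_R t z (pairPath wp))) u‖ ≤
      (driftA₀ ω₂ γ N + driftA₁ lam β N * √((pinnedChain ω₂ lam β γ).hamiltonian N
        ((pinnedChain ω₂ lam β γ).solMap N T_L T_R t z (pairPath wp)))) * ‖u‖ :=
    fun t u => norm_fderiv_drift_apply_le hω hl hβ hγ N _ u
  have ha0 : ∀ t, 0 ≤ driftA₀ ω₂ γ N + driftA₁ lam β N *
      √((pinnedChain ω₂ lam β γ).hamiltonian N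
        ((pinnedChain ω₂ lam β γ).solMap N T_L T_R t z (pairPath wp))) :=
    fun t => add_nonneg (driftA₀_nonneg hω.le hγ N)
      (mul_nonneg (driftA₁_nonneg lam β N) (Real.sqrt_nonneg _))
  have hv1 : ‖v‖ = 1 := by
    rw [hv, Prod.norm_def, norm_zero, Pi.norm_single, norm_one, max_eq_right zero_le_one]
  have hmain := norm_le_mul_exp_integral_of_eq_add_integral (T := 1) hw hAc hac hAa ha0 heq hs
  rw [hv1, one_mul] at hmain
  rw [fderiv_solMap_momentum_eq_variation hω hl hβ hγ N T_L T_R hs (Pi.single b 1) z wp]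
  exact hmain

end Pathwise

end Summit.AtomisticToContinuum.FouriersLaw.Theorems.ExtensiveSnapshotIrreversibility.EnergyWindow

end
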